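import Mathlib
import HarnessLib
import Literature.MathematicalPhysics.StatisticalMechanics.FluctuationDefectLipschitz
import Literature.MathematicalPhysics.StatisticalMechanics.StrongNormExpSecond
import Literature.MathematicalPhysics.StatisticalMechanics.StrongNormExpDifferenceProduct
import Literature.MathematicalPhysics.StatisticalMechanics.RenormalisationMapP2Fluct

/-!
# The second-order block bracket `Φ_B = D_B(H) + (e^{−A_kH(B)} − 1)(1 − e^{−V(B)}) − (e^{−V(B)} − 1 + V(B))`
# of the renormalisation map: size and Lipschitz bounds for the torus data ([ABKM19] Theorem 6.8)

In `GradientRG.nextKStep_sub_opC_eq` (RenormalisationMapRemainder) the single `k`-blocks `B ⊆ U`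
contribute `(p_B − 1)·blockTerm(B) + p_B·Φ_B` with the bracket
`Φ_B(H, V)(φ) = D_B(H)(φ) + (e^{−(A_kH)(B,φ)} − 1)(1 − e^{−V(B,φ)}) − (e^{−V(B,φ)} − 1 + V(B,φ))`,
`V = B_kK` (`FirstOrderCancellationBlock.firstOrder_block_identity`; `D_B` = `fluctDefect`).  This file
proves, on a block `B = B_x` of the torus tower at scale `k` and in the norm `|·|_{T_k^{B*}, w_{k:k+1}^B}`
(the slot norm of `RenormalisationMapLipschitzSlotABKM`):

* **`contDiff_blockBracket_abkm`**, **`isGaugeLocal_blockBracket_abkm`** — regularity and locality;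
* **`tayNormLE_blockBracket_abkm`** — `|Φ_B(H,V)| ≤ 256e^{1/4}((A_𝒫+4)‖H‖² + 2‖H‖‖V‖ + ‖V‖²)`
  (`‖H‖_{k,0} ≤ 1/32`, `‖V‖_{k,0} ≤ 1/16`): second order;
* **`tayNormLE_blockBracket_sub_abkm`** — the Lipschitz bound
  `|Φ_B(H,V) − Φ_B(H',V')| ≤ 512e^{1/4}(A_𝒫+4)(‖H‖+‖H'‖)‖H−H'‖ + 512e^{1/4}(‖H−H'‖‖V‖ + ‖H'‖‖V−V'‖)
   + 256e^{1/4}(‖V'‖ + ‖V−V'‖)‖V−V'‖` (all norms `≤ 1/64`), from the pointwise identity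
  `Φ−Φ' = [D−D'] − [(a−a')(b−1) + (a'−1)(b−b')] − [(b'−1)(e^{−δ}−1) + (e^{−δ}−1+δ)]`
  (`a = e^{−A_kH(B)}`, `b = e^{−V(B)}`, `δ = (V−V')(B)`) and the one-block atoms of
  FluctuationDefect(Lipschitz), StrongNormExpProduct/Second/DifferenceProduct.

Everything is proved; no named fact.

## References
* S. Adams, S. Buchholz, R. Kotecký, S. Müller, arXiv:1910.13564, Theorem 6.8 ((6.56), (6.61)–(6.64)),
  Lemma 9.3, Ch. 9.1 [AdamsBuchholzKoteckyMuller2019].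
-/

noncomputable section

namespace Literature.MathematicalPhysics.StatisticalMechanics.GradientRG

open scoped BigOperators
open Finset MeasureTheory
open Literature.MathematicalPhysics.QuantumFieldTheory
open Literature.MathematicalPhysics.StatisticalMechanics.TorusPolymer
  (IsPolymer blockOf thicken isPolymer_blockOf card_blockOf subset_thicken blocks_blockOf
    card_blocks_eq_numBlocks numBlocks)
open Literature.Barriers.CriticalPhenomena.LongRangePhi4.Polymer (IsConn)

variable {d M : ℕ} [NeZero M]

/-- **The block bracket is local** for `T_k^{B*}` (any `H, V`; the fluctuation integral preserves
locality). [cite: AdamsBuchholzKoteckyMuller2019, Theorem 6.8 / Lemma 6.4 (2)] -/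
theorem isGaugeLocal_blockBracket_abkm {L N Mord R p r₀ : ℕ} {θbar h A : ℝ} {δ' : ℕ → ℝ}
    {𝒞 : ℕ → (Fin d → ZMod M) → ℝ} (hLodd : Odd L) (hh : 0 < h) (hp : d / 2 + 1 ≤ p) (k : ℕ)
    (x : Fin d → ZMod M) (H V : RelevantHamiltonian ℂ d) :
    IsGaugeLocal ((abkmNormParams L N Mord R p r₀ h θbar A δ' 𝒞).gauge k (blockOf (L ^ k) x))
      (fun φ => fluctDefect (𝒞 (k + 1)) H (blockOf (L ^ k) x) φ +
        (expNegH (stepOpA (gradCov (𝒞 (k + 1))) H) (blockOf (L ^ k) x) φ - 1) *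
          (1 - Complex.exp (-(eval V (blockOf (L ^ k) x) φ))) -
        (Complex.exp (-(eval V (blockOf (L ^ k) x) φ)) - 1 + eval V (blockOf (L ^ k) x) φ)) := by
  set P := abkmNormParams L N Mord R p r₀ h θbar A δ' 𝒞 with hP
  set B := blockOf (L ^ k) x with hBdef
  have hL0 : (0 : ℝ) < L := by exact_mod_cast hLodd.pos
  have h𝔥 : 0 < fieldWt h (L : ℝ) d k := fieldWt_pos hh hL0 d k
  have hRk : (0 : ℝ) < (L : ℝ) ^ k := by positivity
  have hBS : B ⊆ thicken (P.rad k) B := subset_thicken _ _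
  have hgauge : P.gauge k B = fieldGauge (fieldWt h (L : ℝ) d k) ((L : ℝ) ^ k) p (thicken (P.rad k) B) := rfl
  have hev : ∀ G : RelevantHamiltonian ℂ d, IsGaugeLocal (P.gauge k B)
      (fun φ : (Fin d → ZMod M) → ℝ => eval G B φ) := fun G => by
    rw [hgauge]; exact isGaugeLocal_eval h𝔥.ne' hRk.ne' hp hBS G
  have hexp_loc : ∀ G : RelevantHamiltonian ℂ d, IsGaugeLocal (P.gauge k B) (expNegH G B) :=
    fun G φ ψ hT => by simp only [expNegH, hev G φ ψ hT]
  have hfl : IsGaugeLocal (P.gauge k B) (fluct (𝒞 (k + 1)) (expNegH H B)) :=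
    isGaugeLocal_fluct _ _ (hexp_loc H)
  intro φ ψ hT
  have e2 := hev (stepOpA (gradCov (𝒞 (k + 1))) H) φ ψ hT
  have e3 := hev V φ ψ hT
  simp only at e2 e3
  simp only [fluctDefect, expNegH]
  rw [hfl φ ψ hT, e2, e3]

/-- **The block bracket is `C^{r₀}`** for the torus tower (`‖H‖_{k,0} ≤ 1/8`, needed to differentiate
the fluctuation integral of `e^{−H(B)}` under the integral sign).
[cite: AdamsBuchholzKoteckyMuller2019, Theorem 6.8 / Lemma 8.4] -/
theorem contDiff_blockBracket_abkm {L N Mord R n p r₀ : ℕ} {θbar lam μ δ₁ δ₀ A𝒫 h A : ℝ}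
    {𝒞 : ℕ → (Fin d → ZMod M) → ℝ} (hd : 2 ≤ d) (hθbar : 0 < θbar) (hlam : 0 < lam)
    (hB : AbkmWeightBounds L N Mord R n θbar lam μ δ₁ δ₀ A𝒫 𝒞
      (abkmWeightData L N Mord R θbar (schedDelta δ₀ δ₁ N) 𝒞))
    (hLodd : Odd L) (hM : M = L ^ N) {k : ℕ} (hk : k ≤ N) (hδ₀ : 0 < δ₀) (hδ₁ : 0 < δ₁) (hh : 0 < h)
    (hh0 : hZeroSq d R δ₀ δ₁ ≤ h ^ 2) (hMord : d / 2 + 1 ≤ Mord) (hp : d / 2 + 1 ≤ p)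
    (x : Fin d → ZMod M) {H : RelevantHamiltonian ℂ d} (V : RelevantHamiltonian ℂ d)
    (hH : hamNorm (fieldWt h (L : ℝ) d k) ((L : ℝ) ^ k) (L ^ (d * k)) H ≤ 1 / 8) :
    ContDiff ℝ r₀
      (fun φ => fluctDefect (𝒞 (k + 1)) H (blockOf (L ^ k) x) φ +
        (expNegH (stepOpA (gradCov (𝒞 (k + 1))) H) (blockOf (L ^ k) x) φ - 1) *
          (1 - Complex.exp (-(eval V (blockOf (L ^ k) x) φ))) -
        (Complex.exp (-(eval V (blockOf (L ^ k) x) φ)) - 1 + eval V (blockOf (L ^ k) x) φ)) := by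
  set P := abkmNormParams L N Mord R p r₀ h θbar A (schedDelta δ₀ δ₁ N) 𝒞 with hP
  set W := abkmWeightData L N Mord R θbar (schedDelta δ₀ δ₁ N) 𝒞 with hW
  set B := blockOf (L ^ k) x with hBdef
  have hL0 : (0 : ℝ) < L := by exact_mod_cast hLodd.pos
  have hk' : k + 1 ≤ N + 1 := by omega
  obtain ⟨t, ht⟩ : ∃ t, N = k + t := ⟨N - k, by omega⟩
  have hMt : M = L ^ k * L ^ t := by rw [← pow_add, ← ht]; exact hM
  have hcard : B.card = L ^ (d * k) := by
    rw [hBdef, card_blockOf hMt hLodd.pow hLodd.pow x, ← pow_mul, mul_comm]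
  have h𝔥 : 0 < fieldWt h (L : ℝ) d k := fieldWt_pos hh hL0 d k
  have hRk : (0 : ℝ) < (L : ℝ) ^ k := by positivity
  have hBS : B ⊆ thicken (P.rad k) B := subset_thicken _ _
  have hgauge : P.gauge k B = fieldGauge (fieldWt h (L : ℝ) d k) ((L : ℝ) ^ k) p (thicken (P.rad k) B) := rfl
  have hSW : ∀ φ, expWeight (strongCoef h N k • derivForm (L : ℝ) k (diffIndex d Mord)
      (boxDensity (boxRad R L k) (boxWt (L : ℝ) d k) B)) φ ≤ W.weight k B φ :=
    fun φ => strongWeight_le_weight_abkm hB hδ₀ hδ₁ hh hh0 k (subset_refl B) φ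
  have hev : ∀ G : RelevantHamiltonian ℂ d, IsGaugeLocal (P.gauge k B)
      (fun φ : (Fin d → ZMod M) → ℝ => eval G B φ) := fun G => by
    rw [hgauge]; exact isGaugeLocal_eval h𝔥.ne' hRk.ne' hp hBS G
  have hexp_loc : ∀ G : RelevantHamiltonian ℂ d, IsGaugeLocal (P.gauge k B) (expNegH G B) :=
    fun G φ ψ hT => by simp only [expNegH, hev G φ ψ hT]
  have hexp_d : ∀ G : RelevantHamiltonian ℂ d, ContDiff ℝ r₀ (expNegH G B) := fun G => by
    show ContDiff ℝ r₀ (fun φ : (Fin d → ZMod M) → ℝ => Complex.exp (-(eval G B φ)))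
    exact (contDiff_eval G B (n := r₀)).neg.cexp
  have hHB : hamNorm (fieldWt h (L : ℝ) d k) ((L : ℝ) ^ k) B.card H ≤ 1 / 8 := by rw [hcard]; exact hH
  have hs := tayNormLE_expNegH_strong_abkm (R := R) (Mord := Mord) hd hLodd hM hk hh hMord hp hBS r₀ hHB
  rw [← hgauge] at hs
  have h1 : ContDiff ℝ r₀ (fluct (𝒞 (k + 1)) (expNegH H B)) :=
    contDiff_fluct_abkm hθbar hlam hB hk' B (P.gauge k B) (Real.exp_pos _).le (hexp_d H) (hexp_loc H)
      (hs.mono_weight (Real.exp_pos _).le hSW)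
  have hD : ContDiff ℝ r₀ (fluctDefect (𝒞 (k + 1)) H B) := by
    show ContDiff ℝ r₀ (fun φ => fluct (𝒞 (k + 1)) (expNegH H B) φ - expNegH (stepOpA (gradCov (𝒞 (k + 1))) H) B φ)
    exact h1.sub (hexp_d _)
  have hV : ContDiff ℝ r₀ (fun φ : (Fin d → ZMod M) → ℝ => Complex.exp (-(eval V B φ))) :=
    (contDiff_eval V B (n := r₀)).neg.cexp
  exact (hD.add (((hexp_d _).sub contDiff_const).mul (contDiff_const.sub hV))).sub
    ((hV.sub contDiff_const).add (contDiff_eval V B))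

/-- **The block bracket is of second order**: on `B = B_x` at scale `k ≤ N` (torus data as in
`tayNormLE_fluctDefect_abkm`: `d ≥ 2`, `L` odd, `M = L^N`, `θ̄, λ, δ₀, δ₁ > 0`, `h² ≥ h₀²`,
`⌊d/2⌋+1 ≤ min(p, M_ord)`, shift `L^{dk}|γ_q| ≤ h²`), for `‖H‖_{k,0} ≤ 1/32`, `‖V‖_{k,0} ≤ 1/16`:
`|Φ_B(H,V)|_{T_k^{B*}, w_{k:k+1}^B} ≤ 256e^{1/4}((A_𝒫 + 4)‖H‖² + 2‖H‖‖V‖ + ‖V‖²)`.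
[cite: AdamsBuchholzKoteckyMuller2019, Theorem 6.8 ((6.56), (6.61)–(6.64))] -/
theorem tayNormLE_blockBracket_abkm {L N Mord R n p r₀ : ℕ} {θbar lam μ δ₁ δ₀ A𝒫 h A : ℝ}
    {𝒞 : ℕ → (Fin d → ZMod M) → ℝ} (hd : 2 ≤ d) (hθbar : 0 < θbar) (hlam : 0 < lam)
    (hB : AbkmWeightBounds L N Mord R n θbar lam μ δ₁ δ₀ A𝒫 𝒞
      (abkmWeightData L N Mord R θbar (schedDelta δ₀ δ₁ N) 𝒞))
    (hLodd : Odd L) (hM : M = L ^ N) {k : ℕ} (hk : k ≤ N) (hδ₀ : 0 < δ₀) (hδ₁ : 0 < δ₁) (hh : 0 < h)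
    (hh0 : hZeroSq d R δ₀ δ₁ ≤ h ^ 2) (hMord : d / 2 + 1 ≤ Mord) (hp : d / 2 + 1 ≤ p)
    (hγ : ∀ q, ((L ^ (d * k) : ℕ) : ℝ) * |gradCov (𝒞 (k + 1)) q| ≤ h ^ 2)
    (x : Fin d → ZMod M) {H V : RelevantHamiltonian ℂ d}
    (hH : hamNorm (fieldWt h (L : ℝ) d k) ((L : ℝ) ^ k) (L ^ (d * k)) H ≤ 1 / 32)
    (hV : hamNorm (fieldWt h (L : ℝ) d k) ((L : ℝ) ^ k) (L ^ (d * k)) V ≤ 1 / 16) :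
    TayNormLE ((abkmNormParams L N Mord R p r₀ h θbar A (schedDelta δ₀ δ₁ N) 𝒞).gauge k (blockOf (L ^ k) x))
      r₀ ((abkmWeightData L N Mord R θbar (schedDelta δ₀ δ₁ N) 𝒞).midWeight k (blockOf (L ^ k) x))
      (fun φ => fluctDefect (𝒞 (k + 1)) H (blockOf (L ^ k) x) φ +
        (expNegH (stepOpA (gradCov (𝒞 (k + 1))) H) (blockOf (L ^ k) x) φ - 1) *
          (1 - Complex.exp (-(eval V (blockOf (L ^ k) x) φ))) -
        (Complex.exp (-(eval V (blockOf (L ^ k) x) φ)) - 1 + eval V (blockOf (L ^ k) x) φ))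
      (256 * Real.exp (1 / 4) *
        ((A𝒫 + 4) * hamNorm (fieldWt h (L : ℝ) d k) ((L : ℝ) ^ k) (L ^ (d * k)) H ^ 2 +
          2 * hamNorm (fieldWt h (L : ℝ) d k) ((L : ℝ) ^ k) (L ^ (d * k)) H *
            hamNorm (fieldWt h (L : ℝ) d k) ((L : ℝ) ^ k) (L ^ (d * k)) V +
          hamNorm (fieldWt h (L : ℝ) d k) ((L : ℝ) ^ k) (L ^ (d * k)) V ^ 2)) := by
  set P := abkmNormParams L N Mord R p r₀ h θbar A (schedDelta δ₀ δ₁ N) 𝒞 with hP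
  set W := abkmWeightData L N Mord R θbar (schedDelta δ₀ δ₁ N) 𝒞 with hW
  set B := blockOf (L ^ k) x with hBdef
  set 𝒸 := 𝒞 (k + 1) with h𝒸
  set AH := stepOpA (gradCov 𝒸) H with hAH
  set nH := hamNorm (fieldWt h (L : ℝ) d k) ((L : ℝ) ^ k) (L ^ (d * k)) H with hnH
  set nV := hamNorm (fieldWt h (L : ℝ) d k) ((L : ℝ) ^ k) (L ^ (d * k)) V with hnV
  have hL0 : (0 : ℝ) < L := by exact_mod_cast hLodd.pos
  have hL1 : 1 ≤ L := hLodd.pos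
  obtain ⟨t, ht⟩ : ∃ t, N = k + t := ⟨N - k, by omega⟩
  have hMt : M = L ^ k * L ^ t := by rw [← pow_add, ← ht]; exact hM
  have hcard : B.card = L ^ (d * k) := by
    rw [hBdef, card_blockOf hMt hLodd.pow hLodd.pow x, ← pow_mul, mul_comm]
  have h𝔥 : 0 < fieldWt h (L : ℝ) d k := fieldWt_pos hh hL0 d k
  have hRk : (0 : ℝ) < (L : ℝ) ^ k := by positivity
  have hnH0 : 0 ≤ nH := hamNorm_nonneg h𝔥.le hRk.le _ _
  have hnV0 : 0 ≤ nV := hamNorm_nonneg h𝔥.le hRk.le _ _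
  have hAH2 : hamNorm (fieldWt h (L : ℝ) d k) ((L : ℝ) ^ k) (L ^ (d * k)) AH ≤ 2 * nH :=
    hamNorm_stepOpA_abkm_le hd hL1 hh k hγ H
  have hnA0 : 0 ≤ hamNorm (fieldWt h (L : ℝ) d k) ((L : ℝ) ^ k) (L ^ (d * k)) AH :=
    hamNorm_nonneg h𝔥.le hRk.le _ _
  have hBS : B ⊆ thicken (P.rad k) B := subset_thicken _ _
  have hgauge : P.gauge k B = fieldGauge (fieldWt h (L : ℝ) d k) ((L : ℝ) ^ k) p (thicken (P.rad k) B) := rfl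
  have hSW : ∀ φ, expWeight (strongCoef h N k • derivForm (L : ℝ) k (diffIndex d Mord)
      (boxDensity (boxRad R L k) (boxWt (L : ℝ) d k) B)) φ ≤ W.weight k B φ :=
    fun φ => strongWeight_le_weight_abkm hB hδ₀ hδ₁ hh hh0 k (subset_refl B) φ
  have hwm : ∀ φ, W.weight k B φ ≤ W.midWeight k B φ := fun φ =>
    WeightData.weight_le_midWeight hB.dominated k B φ
  have hexp_d : ∀ G : RelevantHamiltonian ℂ d, ContDiff ℝ r₀ (expNegH G B) := fun G => by
    show ContDiff ℝ r₀ (fun φ : (Fin d → ZMod M) → ℝ => Complex.exp (-(eval G B φ)))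
    exact (contDiff_eval G B (n := r₀)).neg.cexp
  have hsub1_d : ∀ G : RelevantHamiltonian ℂ d, ContDiff ℝ r₀ (fun φ => expNegH G B φ - 1) :=
    fun G => (hexp_d G).sub contDiff_const
  -- (1) the defect
  have hD := tayNormLE_fluctDefect_abkm (p := p) (r₀ := r₀) (A := A) hd hθbar hlam hB hLodd hM hk hδ₀ hδ₁ hh
    hh0 hMord hp hγ x (H := H) (by linarith)
  have hD_d : ContDiff ℝ r₀ (fluctDefect 𝒸 H B) := by
    have hHB : hamNorm (fieldWt h (L : ℝ) d k) ((L : ℝ) ^ k) B.card H ≤ 1 / 8 := by rw [hcard]; linarith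
    have hs := tayNormLE_expNegH_strong_abkm (R := R) (Mord := Mord) hd hLodd hM hk hh hMord hp hBS r₀ hHB
    rw [← hgauge] at hs
    have hexp_loc : IsGaugeLocal (P.gauge k B) (expNegH H B) := fun φ ψ hT => by
      have hev : IsGaugeLocal (P.gauge k B) (fun φ : (Fin d → ZMod M) → ℝ => eval H B φ) := by
        rw [hgauge]; exact isGaugeLocal_eval h𝔥.ne' hRk.ne' hp hBS H
      simp only [expNegH, hev φ ψ hT]
    have h1 : ContDiff ℝ r₀ (fluct 𝒸 (expNegH H B)) :=
      contDiff_fluct_abkm hθbar hlam hB (by omega) B (P.gauge k B) (Real.exp_pos _).le (hexp_d H) hexp_loc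
        (hs.mono_weight (Real.exp_pos _).le hSW)
    show ContDiff ℝ r₀ (fun φ => fluct 𝒸 (expNegH H B) φ - expNegH (stepOpA (gradCov 𝒸) H) B φ)
    exact h1.sub (hexp_d _)
  -- (2) the product `(e^{−AH} − 1)(e^{−V} − 1)`
  set Pa : ((Fin d → ZMod M) → ℝ) → ℂ := fun ψ => (expNegH AH B ψ - 1) * (expNegH V B ψ - 1) with hPa
  have hAHB : hamNorm (fieldWt h (L : ℝ) d k) ((L : ℝ) ^ k) B.card AH ≤ 1 / 16 := by rw [hcard]; linarith
  have hVB : hamNorm (fieldWt h (L : ℝ) d k) ((L : ℝ) ^ k) B.card V ≤ 1 / 16 := by rw [hcard]; exact hV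
  have hPa_s := tayNormLE_expNegH_sub_one_mul_strong_abkm (R := R) (Mord := Mord) hd hLodd hM hk hh hMord hp
    hBS r₀ hAHB hVB
  rw [← hgauge, hcard] at hPa_s
  have hc2 : 0 ≤ 256 * Real.exp (1 / 4) * hamNorm (fieldWt h (L : ℝ) d k) ((L : ℝ) ^ k) (L ^ (d * k)) AH * nV := by
    positivity
  have hPa_w : TayNormLE (P.gauge k B) r₀ (W.midWeight k B) Pa
      (256 * Real.exp (1 / 4) * hamNorm (fieldWt h (L : ℝ) d k) ((L : ℝ) ^ k) (L ^ (d * k)) AH * nV) :=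
    (hPa_s.mono_weight hc2 hSW).mono_weight hc2 hwm
  have hPa_d : ContDiff ℝ r₀ Pa := (hsub1_d AH).mul (hsub1_d V)
  -- (3) the second-order bracket `e^{−V} − 1 + V`
  set Se : ((Fin d → ZMod M) → ℝ) → ℂ := fun ψ => expNegH V B ψ - 1 + eval V B ψ with hSe
  have hVB8 : hamNorm (fieldWt h (L : ℝ) d k) ((L : ℝ) ^ k) B.card V ≤ 1 / 8 := by rw [hcard]; linarith
  have hSe_s := tayNormLE_expNegH_sub_one_add_strong_abkm (R := R) (Mord := Mord) hd hLodd hM hk hh hMord hp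
    hBS r₀ hVB8
  rw [← hgauge, hcard] at hSe_s
  have hc3 : 0 ≤ 256 * Real.exp (1 / 4) * nV ^ 2 := by positivity
  have hSe_w : TayNormLE (P.gauge k B) r₀ (W.midWeight k B) Se (256 * Real.exp (1 / 4) * nV ^ 2) :=
    (hSe_s.mono_weight hc3 hSW).mono_weight hc3 hwm
  have hSe_d : ContDiff ℝ r₀ Se := (hsub1_d V).add (contDiff_eval V B)
  -- the identity `Φ = D + (−1)•Pa + (−1)•Se`
  have heq : (fun φ => fluctDefect 𝒸 H B φ +
        (expNegH (stepOpA (gradCov 𝒸) H) B φ - 1) * (1 - Complex.exp (-(eval V B φ))) -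
        (Complex.exp (-(eval V B φ)) - 1 + eval V B φ)) =
      fluctDefect 𝒸 H B + ((-1 : ℝ) • Pa + (-1 : ℝ) • Se) := by
    funext φ
    simp only [Pi.add_apply, Pi.smul_apply]
    simp only [neg_one_smul, hPa, hSe, expNegH, hAH]
    ring
  rw [heq]
  have hsum := hD.add (((hPa_w.smul hPa_d (-1)).add (hSe_w.smul hSe_d (-1))) (hPa_d.const_smul (-1 : ℝ))
    (hSe_d.const_smul (-1 : ℝ))) hD_d ((hPa_d.const_smul (-1 : ℝ)).add (hSe_d.const_smul (-1 : ℝ)))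
  refine hsum.mono ?_ (fun φ => (W.midWeight_pos k B φ).le)
  rw [abs_neg, abs_one, one_mul, one_mul]
  have he : 0 ≤ 256 * Real.exp (1 / 4) := by positivity
  have hAV : hamNorm (fieldWt h (L : ℝ) d k) ((L : ℝ) ^ k) (L ^ (d * k)) AH * nV ≤ 2 * nH * nV :=
    mul_le_mul_of_nonneg_right hAH2 hnV0
  nlinarith [mul_le_mul_of_nonneg_left hAV he]

/-- **Lipschitz bound of the block bracket**: on `B = B_x` at scale `k ≤ N` (torus data as in
`tayNormLE_fluctDefect_sub_abkm`, `A_𝒫 ≥ 0`), for `‖H‖, ‖H'‖, ‖V‖, ‖V'‖ ≤ 1/64` (scale-`k` coefficient norms):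
`|Φ_B(H,V) − Φ_B(H',V')|_{T_k^{B*}, w_{k:k+1}^B} ≤ 512e^{1/4}(A_𝒫+4)(‖H‖+‖H'‖)‖H−H'‖`
`+ 512e^{1/4}(‖H−H'‖‖V‖ + ‖H'‖‖V−V'‖) + 256e^{1/4}(‖V'‖ + ‖V−V'‖)‖V−V'‖`.
[cite: AdamsBuchholzKoteckyMuller2019, Theorem 6.8 ((6.56), (6.61)–(6.64))] -/
theorem tayNormLE_blockBracket_sub_abkm {L N Mord R n p r₀ : ℕ} {θbar lam μ δ₁ δ₀ A𝒫 h A : ℝ}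
    {𝒞 : ℕ → (Fin d → ZMod M) → ℝ} (hd : 2 ≤ d) (hθbar : 0 < θbar) (hlam : 0 < lam)
    (hB : AbkmWeightBounds L N Mord R n θbar lam μ δ₁ δ₀ A𝒫 𝒞
      (abkmWeightData L N Mord R θbar (schedDelta δ₀ δ₁ N) 𝒞)) (hA𝒫 : 0 ≤ A𝒫)
    (hLodd : Odd L) (hM : M = L ^ N) {k : ℕ} (hk : k ≤ N) (hδ₀ : 0 < δ₀) (hδ₁ : 0 < δ₁) (hh : 0 < h)
    (hh0 : hZeroSq d R δ₀ δ₁ ≤ h ^ 2) (hMord : d / 2 + 1 ≤ Mord) (hp : d / 2 + 1 ≤ p)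
    (hγ : ∀ q, ((L ^ (d * k) : ℕ) : ℝ) * |gradCov (𝒞 (k + 1)) q| ≤ h ^ 2)
    (x : Fin d → ZMod M) {H H' V V' : RelevantHamiltonian ℂ d}
    (hH : hamNorm (fieldWt h (L : ℝ) d k) ((L : ℝ) ^ k) (L ^ (d * k)) H ≤ 1 / 64)
    (hH' : hamNorm (fieldWt h (L : ℝ) d k) ((L : ℝ) ^ k) (L ^ (d * k)) H' ≤ 1 / 64)
    (hV : hamNorm (fieldWt h (L : ℝ) d k) ((L : ℝ) ^ k) (L ^ (d * k)) V ≤ 1 / 64)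
    (hV' : hamNorm (fieldWt h (L : ℝ) d k) ((L : ℝ) ^ k) (L ^ (d * k)) V' ≤ 1 / 64) :
    TayNormLE ((abkmNormParams L N Mord R p r₀ h θbar A (schedDelta δ₀ δ₁ N) 𝒞).gauge k (blockOf (L ^ k) x))
      r₀ ((abkmWeightData L N Mord R θbar (schedDelta δ₀ δ₁ N) 𝒞).midWeight k (blockOf (L ^ k) x))
      (fun φ => (fluctDefect (𝒞 (k + 1)) H (blockOf (L ^ k) x) φ +
          (expNegH (stepOpA (gradCov (𝒞 (k + 1))) H) (blockOf (L ^ k) x) φ - 1) *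
            (1 - Complex.exp (-(eval V (blockOf (L ^ k) x) φ))) -
          (Complex.exp (-(eval V (blockOf (L ^ k) x) φ)) - 1 + eval V (blockOf (L ^ k) x) φ)) -
        (fluctDefect (𝒞 (k + 1)) H' (blockOf (L ^ k) x) φ +
          (expNegH (stepOpA (gradCov (𝒞 (k + 1))) H') (blockOf (L ^ k) x) φ - 1) *
            (1 - Complex.exp (-(eval V' (blockOf (L ^ k) x) φ))) -
          (Complex.exp (-(eval V' (blockOf (L ^ k) x) φ)) - 1 + eval V' (blockOf (L ^ k) x) φ)))
      (512 * Real.exp (1 / 4) * (A𝒫 + 4) *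
          (hamNorm (fieldWt h (L : ℝ) d k) ((L : ℝ) ^ k) (L ^ (d * k)) H +
            hamNorm (fieldWt h (L : ℝ) d k) ((L : ℝ) ^ k) (L ^ (d * k)) H') *
          hamNorm (fieldWt h (L : ℝ) d k) ((L : ℝ) ^ k) (L ^ (d * k)) (H - H') +
        512 * Real.exp (1 / 4) *
          (hamNorm (fieldWt h (L : ℝ) d k) ((L : ℝ) ^ k) (L ^ (d * k)) (H - H') *
              hamNorm (fieldWt h (L : ℝ) d k) ((L : ℝ) ^ k) (L ^ (d * k)) V +
            hamNorm (fieldWt h (L : ℝ) d k) ((L : ℝ) ^ k) (L ^ (d * k)) H' *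
              hamNorm (fieldWt h (L : ℝ) d k) ((L : ℝ) ^ k) (L ^ (d * k)) (V - V')) +
        256 * Real.exp (1 / 4) *
          (hamNorm (fieldWt h (L : ℝ) d k) ((L : ℝ) ^ k) (L ^ (d * k)) V' +
            hamNorm (fieldWt h (L : ℝ) d k) ((L : ℝ) ^ k) (L ^ (d * k)) (V - V')) *
          hamNorm (fieldWt h (L : ℝ) d k) ((L : ℝ) ^ k) (L ^ (d * k)) (V - V')) := by
  set P := abkmNormParams L N Mord R p r₀ h θbar A (schedDelta δ₀ δ₁ N) 𝒞 with hP
  set W := abkmWeightData L N Mord R θbar (schedDelta δ₀ δ₁ N) 𝒞 with hW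
  set B := blockOf (L ^ k) x with hBdef
  set 𝒸 := 𝒞 (k + 1) with h𝒸
  set AH := stepOpA (gradCov 𝒸) H with hAH
  set AH' := stepOpA (gradCov 𝒸) H' with hAH'
  set Δ := V - V' with hΔ
  set nH := hamNorm (fieldWt h (L : ℝ) d k) ((L : ℝ) ^ k) (L ^ (d * k)) H with hnH
  set nH' := hamNorm (fieldWt h (L : ℝ) d k) ((L : ℝ) ^ k) (L ^ (d * k)) H' with hnH'
  set nHH := hamNorm (fieldWt h (L : ℝ) d k) ((L : ℝ) ^ k) (L ^ (d * k)) (H - H') with hnHH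
  set nV := hamNorm (fieldWt h (L : ℝ) d k) ((L : ℝ) ^ k) (L ^ (d * k)) V with hnV
  set nV' := hamNorm (fieldWt h (L : ℝ) d k) ((L : ℝ) ^ k) (L ^ (d * k)) V' with hnV'
  set nΔ := hamNorm (fieldWt h (L : ℝ) d k) ((L : ℝ) ^ k) (L ^ (d * k)) Δ with hnΔ
  have hL0 : (0 : ℝ) < L := by exact_mod_cast hLodd.pos
  have hL1 : 1 ≤ L := hLodd.pos
  obtain ⟨t, ht⟩ : ∃ t, N = k + t := ⟨N - k, by omega⟩
  have hMt : M = L ^ k * L ^ t := by rw [← pow_add, ← ht]; exact hM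
  have hcard : B.card = L ^ (d * k) := by
    rw [hBdef, card_blockOf hMt hLodd.pow hLodd.pow x, ← pow_mul, mul_comm]
  have h𝔥 : 0 < fieldWt h (L : ℝ) d k := fieldWt_pos hh hL0 d k
  have hRk : (0 : ℝ) < (L : ℝ) ^ k := by positivity
  have hnn : ∀ G : RelevantHamiltonian ℂ d, 0 ≤ hamNorm (fieldWt h (L : ℝ) d k) ((L : ℝ) ^ k) (L ^ (d * k)) G :=
    fun G => hamNorm_nonneg h𝔥.le hRk.le _ _
  have hnH0 : 0 ≤ nH := hnn H
  have hnH'0 : 0 ≤ nH' := hnn H'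
  have hnHH0 : 0 ≤ nHH := hnn (H - H')
  have hnV0 : 0 ≤ nV := hnn V
  have hnV'0 : 0 ≤ nV' := hnn V'
  have hnΔ0 : 0 ≤ nΔ := hnn Δ
  have hnΔle : nΔ ≤ nV + nV' := hamNorm_sub_le h𝔥.le hRk.le _ V V'
  have hnΔ32 : nΔ ≤ 1 / 32 := by linarith
  -- norms of `A H`, `A H'`, `A(H − H')`
  have hAH2 : hamNorm (fieldWt h (L : ℝ) d k) ((L : ℝ) ^ k) (L ^ (d * k)) AH ≤ 2 * nH :=
    hamNorm_stepOpA_abkm_le hd hL1 hh k hγ H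
  have hAH'2 : hamNorm (fieldWt h (L : ℝ) d k) ((L : ℝ) ^ k) (L ^ (d * k)) AH' ≤ 2 * nH' :=
    hamNorm_stepOpA_abkm_le hd hL1 hh k hγ H'
  have hAsub : AH - AH' = stepOpA (gradCov 𝒸) (H - H') := by
    have e := stepOpA_add (gradCov 𝒸) (H - H') H'
    rw [sub_add_cancel] at e
    rw [hAH, hAH', e, add_sub_cancel_right]
  have hAΔ2 : hamNorm (fieldWt h (L : ℝ) d k) ((L : ℝ) ^ k) (L ^ (d * k)) (AH - AH') ≤ 2 * nHH := by
    rw [hAsub]; exact hamNorm_stepOpA_abkm_le hd hL1 hh k hγ (H - H')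
  have hBS : B ⊆ thicken (P.rad k) B := subset_thicken _ _
  have hgauge : P.gauge k B = fieldGauge (fieldWt h (L : ℝ) d k) ((L : ℝ) ^ k) p (thicken (P.rad k) B) := rfl
  -- weights: strong ≤ weak ≤ mid
  have hSW : ∀ φ, expWeight (strongCoef h N k • derivForm (L : ℝ) k (diffIndex d Mord)
      (boxDensity (boxRad R L k) (boxWt (L : ℝ) d k) B)) φ ≤ W.weight k B φ :=
    fun φ => strongWeight_le_weight_abkm hB hδ₀ hδ₁ hh hh0 k (subset_refl B) φ
  have hwm : ∀ φ, W.weight k B φ ≤ W.midWeight k B φ := fun φ =>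
    WeightData.weight_le_midWeight hB.dominated k B φ
  have hexp_d : ∀ G : RelevantHamiltonian ℂ d, ContDiff ℝ r₀ (expNegH G B) := fun G => by
    show ContDiff ℝ r₀ (fun φ : (Fin d → ZMod M) → ℝ => Complex.exp (-(eval G B φ)))
    exact (contDiff_eval G B (n := r₀)).neg.cexp
  have hsub1_d : ∀ G : RelevantHamiltonian ℂ d, ContDiff ℝ r₀ (fun φ => expNegH G B φ - 1) :=
    fun G => (hexp_d G).sub contDiff_const
  -- (1) the defect difference
  have hD := tayNormLE_fluctDefect_sub_abkm (p := p) (r₀ := r₀) (A := A) hd hθbar hlam hB hA𝒫 hLodd hM hk hδ₀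
    hδ₁ hh hh0 hMord hp hγ x hH hH'
  have hD_d : ∀ G : RelevantHamiltonian ℂ d, hamNorm (fieldWt h (L : ℝ) d k) ((L : ℝ) ^ k) (L ^ (d * k)) G ≤ 1 / 8 →
      ContDiff ℝ r₀ (fluctDefect 𝒸 G B) := by
    intro G hG
    have hGB : hamNorm (fieldWt h (L : ℝ) d k) ((L : ℝ) ^ k) B.card G ≤ 1 / 8 := by rw [hcard]; exact hG
    have hs := tayNormLE_expNegH_strong_abkm (R := R) (Mord := Mord) hd hLodd hM hk hh hMord hp hBS r₀ hGB
    rw [← hgauge] at hs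
    have hexp_loc : IsGaugeLocal (P.gauge k B) (expNegH G B) := fun φ ψ hT => by
      have hev : IsGaugeLocal (P.gauge k B) (fun φ : (Fin d → ZMod M) → ℝ => eval G B φ) := by
        rw [hgauge]; exact isGaugeLocal_eval h𝔥.ne' hRk.ne' hp hBS G
      simp only [expNegH, hev φ ψ hT]
    have h1 : ContDiff ℝ r₀ (fluct 𝒸 (expNegH G B)) :=
      contDiff_fluct_abkm hθbar hlam hB (by omega) B (P.gauge k B) (Real.exp_pos _).le (hexp_d G) hexp_loc
        (hs.mono_weight (Real.exp_pos _).le hSW)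
    show ContDiff ℝ r₀ (fun φ => fluct 𝒸 (expNegH G B) φ - expNegH (stepOpA (gradCov 𝒸) G) B φ)
    exact h1.sub (hexp_d _)
  have hDd : ContDiff ℝ r₀ (fun φ => fluctDefect 𝒸 H B φ - fluctDefect 𝒸 H' B φ) :=
    (hD_d H (by linarith)).sub (hD_d H' (by linarith))
  -- (2) the mixed atom `(e^{−AH} − e^{−AH'})(e^{−V} − 1)`
  set M₁ : ((Fin d → ZMod M) → ℝ) → ℂ := fun ψ => (expNegH AH B ψ - expNegH AH' B ψ) * (expNegH V B ψ - 1)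
    with hM₁
  have hM₁_s := tayNormLE_expNegH_sub_mul_sub_one_strong_abkm (R := R) (Mord := Mord) hd hLodd hM hk hh hMord hp
    hBS r₀ (H₁ := AH) (H₂ := AH') (H₃ := V) (by rw [hcard]; linarith) (by rw [hcard]; linarith)
    (by rw [hcard]; linarith)
  rw [← hgauge, hcard] at hM₁_s
  have hc₁ : 0 ≤ 256 * Real.exp (1 / 4) * hamNorm (fieldWt h (L : ℝ) d k) ((L : ℝ) ^ k) (L ^ (d * k)) (AH - AH') *
      nV := by
    have := hnn (AH - AH'); positivity
  have hM₁_w : TayNormLE (P.gauge k B) r₀ (W.midWeight k B) M₁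
      (256 * Real.exp (1 / 4) * hamNorm (fieldWt h (L : ℝ) d k) ((L : ℝ) ^ k) (L ^ (d * k)) (AH - AH') * nV) :=
    (hM₁_s.mono_weight hc₁ hSW).mono_weight hc₁ hwm
  have hM₁_d : ContDiff ℝ r₀ M₁ := ((hexp_d AH).sub (hexp_d AH')).mul (hsub1_d V)
  -- (3) the mixed atom `(e^{−V} − e^{−V'})(e^{−AH'} − 1)`
  set M₂ : ((Fin d → ZMod M) → ℝ) → ℂ := fun ψ => (expNegH V B ψ - expNegH V' B ψ) * (expNegH AH' B ψ - 1)
    with hM₂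
  have hM₂_s := tayNormLE_expNegH_sub_mul_sub_one_strong_abkm (R := R) (Mord := Mord) hd hLodd hM hk hh hMord hp
    hBS r₀ (H₁ := V) (H₂ := V') (H₃ := AH') (by rw [hcard]; linarith) (by rw [hcard]; linarith)
    (by rw [hcard]; linarith)
  rw [← hgauge, hcard] at hM₂_s
  have hc₂ : 0 ≤ 256 * Real.exp (1 / 4) * nΔ * hamNorm (fieldWt h (L : ℝ) d k) ((L : ℝ) ^ k) (L ^ (d * k)) AH' := by
    have := hnn AH'; positivity
  have hM₂_w : TayNormLE (P.gauge k B) r₀ (W.midWeight k B) M₂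
      (256 * Real.exp (1 / 4) * nΔ * hamNorm (fieldWt h (L : ℝ) d k) ((L : ℝ) ^ k) (L ^ (d * k)) AH') :=
    (hM₂_s.mono_weight hc₂ hSW).mono_weight hc₂ hwm
  have hM₂_d : ContDiff ℝ r₀ M₂ := ((hexp_d V).sub (hexp_d V')).mul (hsub1_d AH')
  -- (4) the product `(e^{−V'} − 1)(e^{−Δ} − 1)`
  set Pr : ((Fin d → ZMod M) → ℝ) → ℂ := fun ψ => (expNegH V' B ψ - 1) * (expNegH Δ B ψ - 1) with hPr
  have hPr_s := tayNormLE_expNegH_sub_one_mul_strong_abkm (R := R) (Mord := Mord) hd hLodd hM hk hh hMord hp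
    hBS r₀ (H₁ := V') (H₂ := Δ) (by rw [hcard]; linarith) (by rw [hcard]; linarith)
  rw [← hgauge, hcard] at hPr_s
  have hc₃ : 0 ≤ 256 * Real.exp (1 / 4) * nV' * nΔ := by positivity
  have hPr_w : TayNormLE (P.gauge k B) r₀ (W.midWeight k B) Pr (256 * Real.exp (1 / 4) * nV' * nΔ) :=
    (hPr_s.mono_weight hc₃ hSW).mono_weight hc₃ hwm
  have hPr_d : ContDiff ℝ r₀ Pr := (hsub1_d V').mul (hsub1_d Δ)
  -- (5) the second-order bracket of `Δ`
  set Se : ((Fin d → ZMod M) → ℝ) → ℂ := fun ψ => expNegH Δ B ψ - 1 + eval Δ B ψ with hSe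
  have hSe_s := tayNormLE_expNegH_sub_one_add_strong_abkm (R := R) (Mord := Mord) hd hLodd hM hk hh hMord hp
    hBS r₀ (H := Δ) (by rw [hcard]; linarith)
  rw [← hgauge, hcard] at hSe_s
  have hc₄ : 0 ≤ 256 * Real.exp (1 / 4) * nΔ ^ 2 := by positivity
  have hSe_w : TayNormLE (P.gauge k B) r₀ (W.midWeight k B) Se (256 * Real.exp (1 / 4) * nΔ ^ 2) :=
    (hSe_s.mono_weight hc₄ hSW).mono_weight hc₄ hwm
  have hSe_d : ContDiff ℝ r₀ Se := (hsub1_d Δ).add (contDiff_eval Δ B)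
  -- the pointwise identity
  have hVsum : V = V' + Δ := by rw [hΔ]; abel
  have heq : (fun φ => (fluctDefect 𝒸 H B φ +
          (expNegH (stepOpA (gradCov 𝒸) H) B φ - 1) * (1 - Complex.exp (-(eval V B φ))) -
          (Complex.exp (-(eval V B φ)) - 1 + eval V B φ)) -
        (fluctDefect 𝒸 H' B φ +
          (expNegH (stepOpA (gradCov 𝒸) H') B φ - 1) * (1 - Complex.exp (-(eval V' B φ))) -
          (Complex.exp (-(eval V' B φ)) - 1 + eval V' B φ))) =
      (fun φ => fluctDefect 𝒸 H B φ - fluctDefect 𝒸 H' B φ) +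
        (((-1 : ℝ) • M₁ + (-1 : ℝ) • M₂) + ((-1 : ℝ) • Pr + (-1 : ℝ) • Se)) := by
    funext φ
    simp only [Pi.add_apply, Pi.smul_apply]
    simp only [neg_one_smul, hM₁, hM₂, hPr, hSe, expNegH, hAH, hAH']
    have hfacV : Complex.exp (-(eval V B φ)) = Complex.exp (-(eval V' B φ)) * Complex.exp (-(eval Δ B φ)) := by
      rw [hVsum, eval_add, neg_add, Complex.exp_add]
    have heV : eval V B φ = eval V' B φ + eval Δ B φ := by rw [hVsum, eval_add]
    rw [hfacV, heV]
    ring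
  rw [heq]
  -- combine
  have h23 := (hM₁_w.smul hM₁_d (-1)).add (hM₂_w.smul hM₂_d (-1)) (hM₁_d.const_smul (-1 : ℝ))
    (hM₂_d.const_smul (-1 : ℝ))
  have h45 := (hPr_w.smul hPr_d (-1)).add (hSe_w.smul hSe_d (-1)) (hPr_d.const_smul (-1 : ℝ))
    (hSe_d.const_smul (-1 : ℝ))
  have h2345 := h23.add h45 ((hM₁_d.const_smul (-1 : ℝ)).add (hM₂_d.const_smul (-1 : ℝ)))
    ((hPr_d.const_smul (-1 : ℝ)).add (hSe_d.const_smul (-1 : ℝ)))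
  have hsum := hD.add h2345 hDd (((hM₁_d.const_smul (-1 : ℝ)).add (hM₂_d.const_smul (-1 : ℝ))).add
    ((hPr_d.const_smul (-1 : ℝ)).add (hSe_d.const_smul (-1 : ℝ))))
  refine hsum.mono ?_ (fun φ => (W.midWeight_pos k B φ).le)
  simp only [abs_neg, abs_one, one_mul]
  have he : 0 ≤ 256 * Real.exp (1 / 4) := by positivity
  have hb1 : hamNorm (fieldWt h (L : ℝ) d k) ((L : ℝ) ^ k) (L ^ (d * k)) (AH - AH') * nV ≤ 2 * nHH * nV :=
    mul_le_mul_of_nonneg_right hAΔ2 hnV0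
  have hb2 : nΔ * hamNorm (fieldWt h (L : ℝ) d k) ((L : ℝ) ^ k) (L ^ (d * k)) AH' ≤ nΔ * (2 * nH') :=
    mul_le_mul_of_nonneg_left hAH'2 hnΔ0
  have hsq : nΔ ^ 2 = nΔ * nΔ := sq nΔ
  nlinarith [mul_le_mul_of_nonneg_left hb1 he, mul_le_mul_of_nonneg_left hb2 he, mul_nonneg he (mul_nonneg hnV'0 hnΔ0),
    mul_nonneg he (mul_nonneg hnΔ0 hnΔ0)]

end Literature.MathematicalPhysics.StatisticalMechanics.GradientRG

end
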